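import Literature.Computability.AlgebraicComplexity.BLMW11ApproximationProjections
import Literature.Computability.AlgebraicComplexity.ApproxComplexityProjections
import HarnessLib

/-!
# BLMW 2011 §9.3: `\overline{VP_ws} ⊆ \overline{VP}`

Bürgisser–Landsberg–Manivel–Weyman 2011, §9.3 (arXiv:0907.2850, p. 21): "Similarly, one defines
the classes `\overline{VP}`. Clearly, `\overline{VP_ws} ⊆ \overline{VP}` …". For the tree's
`approxComplexity` / `approxWsComplexity` / `IsVPBarFamily` / `IsVPwsBarFamily`
(`BLMW11KroneckerApproximation.lean`): `L(f) ≤ L_ws(f)` pointwise (a size-optimal weakly-skew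
circuit is a fan-in-two circuit), hence `{g | L_ws(g) ≤ r} ⊆ {g | L(g) ≤ r}`, hence
`\underline{L}(f) ≤ \underline{L_ws}(f)` and the class inclusion. (The p-projection closures of the
two classes are `IsVPwsBarFamily.of_isPProjection` and `IsVPBarFamily.of_isPProjection` of the
imported files.) Theorems only; cell `val-lit`, seat t14.

## References
* [BLMW 2011] SIAM J. Comput. 40 (2011), §9.3 (arXiv p. 21). Bib key `BurgisserEtAl2011`.
-/

open MvPolynomial

namespace Literature.Computability.AlgebraicComplexity

section VPBar

variable {k : Type*} [CommSemiring k] {σ : Type*}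

open ArithCircuit

/-- `L(f) ≤ L_ws(f)`: a size-optimal weakly-skew circuit is in particular a fan-in-two circuit
(BLMW 2011 §9.1, "Restricting to weakly-skew circuits … `L_ws(f)`"). [cite: BurgisserEtAl2011, §9.1 (L_ws)] -/
theorem complexity_le_wsComplexity (f : MvPolynomial σ k) : complexity f ≤ wsComplexity f := by
  obtain ⟨P, _, h2, _, hc, hsz⟩ := HI16Skew.wsComplexity_attained f
  rw [← hsz]
  exact complexity_le_size h2 hc

end VPBar

section ApproxVP

variable {σ : Type*}

/-- **`\underline{L}(f) ≤ \underline{L_ws}(f)`** — "Clearly, `\overline{VP_ws} ⊆ \overline{VP}`",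
pointwise: `{g | L_ws(g) ≤ r} ⊆ {g | L(g) ≤ r}`. [cite: BurgisserEtAl2011, §9.3 (VP_ws-bar ⊆ VP-bar)] -/
theorem approxComplexity_le_approxWsComplexity (f : MvPolynomial σ ℂ) :
    approxComplexity f ≤ approxWsComplexity f := by
  refine approxComplexity_le_of_mem (zariskiClosure_mono ?_
    (coeffVec_mem_zariskiClosure_approxWsComplexity f))
  rintro _ ⟨g, hg, rfl⟩
  exact ⟨g, (complexity_le_wsComplexity g).trans hg, rfl⟩

/-- **BLMW 2011 §9.3: `\overline{VP_ws} ⊆ \overline{VP}`.** [cite: BurgisserEtAl2011, §9.3 (VP_ws-bar ⊆ VP-bar)] -/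
theorem IsVPwsBarFamily.isVPBarFamily {σ' : ℕ → Type*} [∀ n, Fintype (σ' n)]
    [∀ n, DecidableEq (σ' n)] {f : ∀ n, MvPolynomial (σ' n) ℂ} (hf : IsVPwsBarFamily f) :
    IsVPBarFamily f :=
  hf.mono fun n => approxComplexity_le_approxWsComplexity (f n)

/-- `VP_ws ⊆ VP`-type pointwise consequence: a `VP_ws` family has p-bounded circuit complexity
(BLMW 2011 §9.1). [cite: BurgisserEtAl2011, §9.1 (VP_ws)] -/
theorem IsVPwsFamily.isPBounded_complexity {k : Type*} [CommSemiring k] {σ' : ℕ → Type*}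
    {f : ∀ n, MvPolynomial (σ' n) k} (hf : IsVPwsFamily f) :
    IsPBounded fun n => complexity (f n) :=
  hf.mono fun n => complexity_le_wsComplexity (f n)

end ApproxVP

end Literature.Computability.AlgebraicComplexity
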